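import Summits.Parity.BatemanHorn.Theses.RoughValueTransport
import Summits.Parity.BatemanHorn.Theorems.RoughValueTransportBalancedSemiprimeLayerDegreeLeTwo
import Summits.Parity.BatemanHorn.Theorems.RoughValueTransportSieveCalibration
import Summits.Parity.BatemanHorn.Theorems.RoughValueTransportAssembly
import Literature.NumberTheory.Sieve.BuchstabLimitFact
import Literature.NumberTheory.Sieve.BatemanHornProofs
import Literature.NumberTheory.Sieve.ParityBatemanHornProofs
import Literature.NumberTheory.Sieve.AletheiaZomleferFukshanskyGarcia2020Applications
import Literature.NumberTheory.Sieve.SingularSeriesProofs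
import HarnessLib

/-!
# Crux `RoughValueLaw` (stmt-Parity-11390, route `RoughValueTransport`): STRENGTH CERTIFICATE

`RoughValueLaw` (Buchstab shape of the jointly rough values of every Bateman–Horn system beyond the
prime threshold, constant free) is filed `[difficulty: open-problem]`, and three line leads have
reduced it to kernel-checked normal forms whose open remainder is the crux itself
(`IncrementAnchoring.roughValueLaw_iff_ratioLaws`, `FriableDeepTail.residual_iff_roughValueLaw`).
This file records, as theorems, HOW STRONG the crux is — the precise reason those lines end where
they do.

Since the sibling crux `BalancedSemiprimeLayer` is PROVED for every system all of whose coordinates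
have degree `≤ 2` (`SmoothModulusTwistedHooley.layerConclusion_of_natDegree_le_two`: linear layer by
switching, quadratic layer by the twisted Hooley lever + uniform Type-I + the `(k+1)`-dimensional
sieve), the support `SieveCalibration` is PROVED (`sieveCalibration_proof`), and the route's assembly
is a per-system squeeze, the crux ALONE already delivers Bateman–Horn for every such system:

* `batemanHornAsymptotic_of_parts` — the route's squeeze for ONE system, with the three route items
  as per-system hypotheses (the body of `roughValueTransportAssembly_proof`, localised);
* `batemanHornAsymptotic_of_systemRoughValueLaw` — for a Bateman–Horn system of degree `≤ 2`, the
  crux's conclusion FOR THAT SYSTEM ALONE implies `BatemanHornAsymptotic f`;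
* `batemanHornAsymptotic_of_roughValueLaw` — `RoughValueLaw → BatemanHornAsymptotic f` for every
  Bateman–Horn system of degree `≤ 2`: the Hardy–Littlewood prime `k`-tuple conjecture for every
  admissible linear system, Hardy–Littlewood's Conjecture E / Landau's problem for `n² + 1`, and
  Bateman–Horn for every system of linear and quadratic polynomials;
* corollaries by name: `twinPrimeCount_isEquivalent_of_roughValueLaw` (`π₂(x) ∼ 2C₂x/(log x)²`),
  `twinPrimeConjecture_of_roughValueLaw`, `hardyLittlewoodConjE_of_roughValueLaw`,
  `landauConjecture_of_roughValueLaw`, `sophieGermain_of_roughValueLaw`.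

Consequently any proof of the two open stubs of line `increment-anchoring`
(`stub_deepRatioLaw ∧ stub_shallowRatioLaw ↔ RoughValueLaw`) or of the residual of line
`friable-deep-tail` (`Residual ↔ RoughValueLaw`) proves the twin prime conjecture; and already the
rung law for the single system `(X, X + 2)` proves the Hardy–Littlewood twin asymptotic
(`twinPrimeCount_isEquivalent_of_systemRoughValueLaw`).  No statement of that strength is supplied
by Type-I information at any level (`Literature.Barriers.Parity.SelbergParityBarrier`,
`LinearSieveOptimality`), which is all either line leans on.

References: P. T. Bateman, R. A. Horn, Math. Comp. 16 (1962); G. H. Hardy, J. E. Littlewood, Acta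
Math. 44 (1923), Conjectures B, E; G. Harman, *Prime-Detecting Sieves* (2007), §1.4.
-/

noncomputable section

open Filter Finset Polynomial Real Asymptotics
open scoped Topology BigOperators
open Literature.NumberTheory.Sieve
open Summit.Parity.BatemanHorn.Theses.RoughValueTransport (RoughValueLaw)
open Summit.Parity.BatemanHorn.Theorems (sieveCalibration_proof)
open Summit.Parity.BatemanHorn.Cruxes.BalancedSemiprimeLayer.SmoothModulusTwistedHooley
  (layerConclusion_of_natDegree_le_two)

namespace Summit.Parity.BatemanHorn.Cruxes.RoughValueLaw.Strength

/-! ### The route's squeeze for one system -/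

/-- **The route's squeeze, localised to ONE Bateman–Horn system.**  If for the system `f` (i) the
rough-value shape holds for every Buchstab `ω` with SOME constant `A` (the body of `RoughValueLaw`),
(ii) the boundary layer at `u = 2⁺` is thin (the body of `BalancedSemiprimeLayer`) and (iii) the
constant is calibrated at infinite depth (the body of `SieveCalibration`), then
`P_f(x) ∼ (C(f)/∏ deg fᵢ)·x/(log x)^k`, i.e. `BatemanHornAsymptotic f`.  Proof = the body of
`roughValueTransportAssembly_proof` (instantiate at `ω = buchstabOmega`; `A = C(f)/∏deg` by (iii) and
de Bruijn's `ω(u) → e^{−γ}`; squeeze `P_f(x)(log x)^k/x → C(f)/∏deg` at depths `u = 2/(1−δ) ↓ 2`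
between (ii) and the elementary "all values prime ⇒ jointly rough up to `O(√x)`"). [folklore] -/
theorem batemanHornAsymptotic_of_parts {k : ℕ} {f : Fin k → ℤ[X]} (hf : IsBatemanHornSystem f)
    (hR : ∀ ω : ℝ → ℝ, ((∀ u : ℝ, 1 ≤ u → u ≤ 2 → ω u = u⁻¹) ∧ ContinuousOn ω (Set.Ici 1) ∧
        (∀ u : ℝ, 2 < u → HasDerivAt (fun t : ℝ => t * ω t) (ω (u - 1)) u)) →
      ∃ A : ℝ, ∀ u : ℝ, 2 < u → Tendsto (fun x : ℕ =>
        (((Finset.Icc 1 x).filter (fun n : ℕ => ∀ i, 0 < (f i).eval (n : ℤ) ∧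
          ∀ p ∈ Finset.range ⌈(x : ℝ) ^ (((f i).natDegree : ℝ) / u)⌉₊,
            p.Prime → ¬ ((p : ℤ) ∣ (f i).eval (n : ℤ)))).card : ℝ) * Real.log x ^ k / (x : ℝ))
        atTop (𝓝 (A * (u * ω u) ^ k)))
    (hL : ∀ ε : ℝ, 0 < ε → ∃ δ : ℝ, 0 < δ ∧ δ ≤ 1 / 4 ∧ ∀ᶠ x : ℕ in atTop,
      (((Finset.Icc 1 x).filter (fun n : ℕ => ∀ i, 0 < (f i).eval (n : ℤ) ∧
          ∀ p ∈ Finset.range ⌈(x : ℝ) ^ (((f i).natDegree : ℝ) * (1 - δ) / 2)⌉₊,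
            p.Prime → ¬ ((p : ℤ) ∣ (f i).eval (n : ℤ)))).card : ℝ) ≤
        (polyPrimeCount f x : ℝ) + ε * (x : ℝ) / Real.log x ^ k)
    (hS : ∀ L : ℝ → ℝ, (∃ u₀ : ℝ, ∀ u : ℝ, u₀ ≤ u → Tendsto (fun x : ℕ =>
        (((Finset.Icc 1 x).filter (fun n : ℕ => ∀ i, 0 < (f i).eval (n : ℤ) ∧
          ∀ p ∈ Finset.range ⌈(x : ℝ) ^ (((f i).natDegree : ℝ) / u)⌉₊,
            p.Prime → ¬ ((p : ℤ) ∣ (f i).eval (n : ℤ)))).card : ℝ) * Real.log x ^ k / (x : ℝ))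
        atTop (𝓝 (L u))) →
      Tendsto (fun u : ℝ => L u / u ^ k) atTop
        (𝓝 (batemanHornConst f / (∏ i, ((f i).natDegree : ℝ)) *
          Real.exp (-((k : ℝ) * Real.eulerMascheroniConstant))))) :
    BatemanHornAsymptotic f := by
  -- the constants `D = ∏ deg fᵢ > 0`, `C(f) > 0`, `C₀ = C(f)/D`
  have hD0 : (0 : ℝ) < ∏ i, ((f i).natDegree : ℝ) :=
    prod_pos fun i _ => by exact_mod_cast hf.natDegree_pos i
  obtain ⟨hconst, hCf0⟩ := IsBatemanHornSystem.hasBatemanHornConst_holds hf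
  obtain ⟨C₀, hC₀_def⟩ : ∃ C₀ : ℝ, C₀ = batemanHornConst f / ∏ i, ((f i).natDegree : ℝ) :=
    ⟨_, rfl⟩
  have hC₀0 : 0 < C₀ := by rw [hC₀_def]; exact div_pos hCf0 hD0
  -- Step 1: `ω = buchstabOmega` satisfies the inline predicate; `A` from the rough-value shape
  obtain ⟨A, hA⟩ := hR buchstabOmega
    ⟨fun u h1 h2 => buchstabOmega_eq_inv h1 h2, continuousOn_buchstabOmega,
      fun u hu => hasDerivAt_mul_buchstabOmega hu⟩
  -- Step 2: calibration with `L u = A (u ω u)^k` and de Bruijn's limit pin `A = C₀`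
  have hSC := hS (fun u => A * (u * buchstabOmega u) ^ k) ⟨3, fun u hu => hA u (by linarith)⟩
  rw [← hC₀_def] at hSC
  have hω := harman2007_buchstabOmega_tendsto_holds
  unfold harman2007_buchstabOmega_tendsto at hω
  have hSC' : Tendsto (fun u : ℝ => A * (u * buchstabOmega u) ^ k / u ^ k) atTop
      (𝓝 (A * Real.exp (-Real.eulerMascheroniConstant) ^ k)) := by
    have h1 := (hω.pow k).const_mul A
    refine h1.congr' ?_
    filter_upwards [eventually_gt_atTop 0] with u hu
    rw [mul_pow]
    field_simp
  have hAeq : A = C₀ := by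
    have huniq := tendsto_nhds_unique hSC' hSC
    have he : Real.exp (-((k : ℝ) * Real.eulerMascheroniConstant)) =
        Real.exp (-Real.eulerMascheroniConstant) ^ k := by
      rw [← Real.exp_nat_mul]
      congr 1
      ring
    rw [he] at huniq
    exact mul_right_cancel₀ (pow_ne_zero k (Real.exp_pos _).ne') huniq
  -- Step 3: at `u = 2/(1−δ)` the count sifted to `x^{deg fᵢ(1−δ)/2}` is `Φ_f(x,u)`, with
  -- normalised limit `C₀ (1 + log((1+δ)/(1−δ)))^k`
  have hdepth : ∀ δ : ℝ, 0 < δ → δ ≤ 1 / 4 →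
      Tendsto (fun x : ℕ => (#((Icc 1 x).filter (fun n : ℕ => ∀ i, 0 < (f i).eval (n : ℤ) ∧
        ∀ p ∈ range ⌈(x : ℝ) ^ (((f i).natDegree : ℝ) * (1 - δ) / 2)⌉₊,
          p.Prime → ¬ ((p : ℤ) ∣ (f i).eval (n : ℤ)))) : ℝ) * Real.log x ^ k / x) atTop
        (𝓝 (C₀ * (1 + Real.log ((1 + δ) / (1 - δ))) ^ k)) := by
    intro δ hδ0 hδ4
    obtain ⟨u, hu_def⟩ : ∃ u : ℝ, u = 2 / (1 - δ) := ⟨_, rfl⟩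
    have h1δ : 0 < 1 - δ := by linarith
    have hu2 : 2 < u := by
      rw [hu_def, lt_div_iff₀ h1δ]; linarith
    have hu3 : u ≤ 3 := by
      rw [hu_def, div_le_iff₀ h1δ]; linarith
    have hexp : ∀ d : ℕ, (d : ℝ) / u = (d : ℝ) * (1 - δ) / 2 := by
      intro d
      rw [hu_def]
      field_simp
    have hcount : ∀ x : ℕ, #((Icc 1 x).filter (fun n : ℕ => ∀ i, 0 < (f i).eval (n : ℤ) ∧
        ∀ p ∈ range ⌈(x : ℝ) ^ (((f i).natDegree : ℝ) / u)⌉₊,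
          p.Prime → ¬ ((p : ℤ) ∣ (f i).eval (n : ℤ)))) =
      #((Icc 1 x).filter (fun n : ℕ => ∀ i, 0 < (f i).eval (n : ℤ) ∧
        ∀ p ∈ range ⌈(x : ℝ) ^ (((f i).natDegree : ℝ) * (1 - δ) / 2)⌉₊,
          p.Prime → ¬ ((p : ℤ) ∣ (f i).eval (n : ℤ)))) := by
      intro x
      congr 1
      ext n
      simp only [mem_filter, hexp]
    have hval : A * (u * buchstabOmega u) ^ k =
        C₀ * (1 + Real.log ((1 + δ) / (1 - δ))) ^ k := by
      rw [hAeq, buchstabOmega_eq_of_mem_Icc_two_three hu2.le hu3]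
      have hu0 : u ≠ 0 := by linarith
      have h1 : u - 1 = (1 + δ) / (1 - δ) := by
        rw [hu_def]
        field_simp
        ring
      rw [mul_div_cancel₀ _ hu0, h1]
    rw [← hval]
    refine (hA u hu2).congr' (Eventually.of_forall fun x => ?_)
    rw [hcount x]
  -- Steps 4–5: the squeeze `P_f(x)(log x)^k/x → C₀`
  have hP : Tendsto (fun x : ℕ => (polyPrimeCount f x : ℝ) * Real.log x ^ k / x) atTop (𝓝 C₀) := by
    rw [tendsto_order]
    constructor
    · -- lower bound, from the thin layer
      intro a ha
      obtain ⟨δ, hδ0, hδ4, hev⟩ := hL ((C₀ - a) / 2) (by linarith)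
      have hlim := hdepth δ hδ0 hδ4
      have hV : C₀ ≤ C₀ * (1 + Real.log ((1 + δ) / (1 - δ))) ^ k := by
        have hlog : 0 ≤ Real.log ((1 + δ) / (1 - δ)) := by
          apply Real.log_nonneg
          rw [le_div_iff₀ (by linarith)]
          linarith
        have h1 : (1 : ℝ) ≤ (1 + Real.log ((1 + δ) / (1 - δ))) ^ k := one_le_pow₀ (by linarith)
        nlinarith
      filter_upwards [hlim.eventually (eventually_gt_nhds (show C₀ - (C₀ - a) / 2 <
          C₀ * (1 + Real.log ((1 + δ) / (1 - δ))) ^ k by linarith)), hev,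
        eventually_gt_atTop 1] with x hx hxev hx1
      have hx' : (1 : ℝ) < x := by exact_mod_cast hx1
      have hlog : 0 < Real.log x := Real.log_pos hx'
      have hx0 : (0 : ℝ) < x := by linarith
      have hpow : 0 < Real.log x ^ k := pow_pos hlog k
      have key : ∀ Φ P ε : ℝ, Φ ≤ P + ε * x / Real.log x ^ k →
          Φ * Real.log x ^ k / x ≤ P * Real.log x ^ k / x + ε := by
        intro Φ P ε h
        have h1 : Φ * Real.log x ^ k / x ≤ (P + ε * x / Real.log x ^ k) * Real.log x ^ k / x :=
          div_le_div_of_nonneg_right (mul_le_mul_of_nonneg_right h hpow.le) hx0.le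
        have h2 : (P + ε * x / Real.log x ^ k) * Real.log x ^ k / x =
            P * Real.log x ^ k / x + ε := by
          field_simp
        linarith
      have := key _ _ _ hxev
      linarith
    · -- upper bound, from `polyPrimeCount_le_cruxCount_add` and continuity in `δ` at `0`
      intro b hb
      have hφc : ContinuousAt
          (fun δ : ℝ => C₀ * (1 + Real.log ((1 + δ) / (1 - δ))) ^ k) 0 := by
        fun_prop (disch := norm_num)
      have hevφ : ∀ᶠ δ : ℝ in 𝓝 0, C₀ * (1 + Real.log ((1 + δ) / (1 - δ))) ^ k < b := by
        have := hφc.tendsto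
        simp only [add_zero, sub_zero, div_one, Real.log_one, one_pow, mul_one] at this
        exact this.eventually (eventually_lt_nhds hb)
      obtain ⟨r, hr, hrφ⟩ := Metric.eventually_nhds_iff.mp hevφ
      obtain ⟨δ, hδ_def⟩ : ∃ δ : ℝ, δ = min (1 / 4) (r / 2) := ⟨_, rfl⟩
      have hδ0 : 0 < δ := by rw [hδ_def]; positivity
      have hδ4 : δ ≤ 1 / 4 := by rw [hδ_def]; exact min_le_left _ _
      have hδr : δ < r := by
        rw [hδ_def]; exact lt_of_le_of_lt (min_le_right _ _) (by linarith)
      have hφδ : C₀ * (1 + Real.log ((1 + δ) / (1 - δ))) ^ k < b :=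
        hrφ (by rw [Real.dist_eq, sub_zero, abs_of_pos hδ0]; exact hδr)
      have hlim := hdepth δ hδ0 hδ4
      obtain ⟨K, hK⟩ :=
        Summit.Parity.BatemanHorn.Theorems.BalancedSemiprimeLayer.Negative.polyPrimeCount_le_cruxCount_add
          f hf.leadingCoeff_pos hf.natDegree_pos hδ0.le
      have hrem := Summit.Parity.BatemanHorn.Theorems.RoughValueTransportAssembly.tendsto_remainder K k
      have hsum := hlim.add hrem
      rw [add_zero] at hsum
      filter_upwards [hsum.eventually (eventually_lt_nhds hφδ), eventually_gt_atTop 1]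
        with x hx hx1
      have hx' : (1 : ℝ) < x := by exact_mod_cast hx1
      have hlog : 0 < Real.log x := Real.log_pos hx'
      have hx0 : (0 : ℝ) < x := by linarith
      have hpow : 0 < Real.log x ^ k := pow_pos hlog k
      have key : ∀ P Φ R : ℝ, P ≤ Φ + K + R →
          P * Real.log x ^ k / x ≤ Φ * Real.log x ^ k / x + (K + R) * Real.log x ^ k / x := by
        intro P Φ R h
        have h1 : P * Real.log x ^ k / x ≤ (Φ + K + R) * Real.log x ^ k / x :=
          div_le_div_of_nonneg_right (mul_le_mul_of_nonneg_right h hpow.le) hx0.le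
        have h2 : (Φ + K + R) * Real.log x ^ k / x =
            Φ * Real.log x ^ k / x + (K + R) * Real.log x ^ k / x := by ring
        linarith
      exact lt_of_le_of_lt (key _ _ _ (hK x)) hx
  -- Step 6: `P_f ~ C₀·x/(log x)^k` with the constant `C(f) = batemanHornConst f`
  refine ⟨batemanHornConst f, hconst, ?_⟩
  rw [Fintype.card_fin, ← hC₀_def]
  have hv : ∀ᶠ x : ℕ in atTop, C₀ * (x : ℝ) / Real.log x ^ k ≠ 0 := by
    filter_upwards [eventually_gt_atTop 1] with x hx
    have hx' : (1 : ℝ) < x := by exact_mod_cast hx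
    have : 0 < Real.log x := Real.log_pos hx'
    positivity
  refine (isEquivalent_iff_tendsto_one hv).mpr ?_
  have h2 := hP.div_const C₀
  rw [div_self hC₀0.ne'] at h2
  refine h2.congr' ?_
  filter_upwards [eventually_gt_atTop 1] with x hx
  have hx' : (1 : ℝ) < x := by exact_mod_cast hx
  have hlog : 0 < Real.log x := Real.log_pos hx'
  have hx0 : (0 : ℝ) < x := by linarith
  have hC₀' : C₀ ≠ 0 := hC₀0.ne'
  simp only [Pi.div_apply]
  field_simp

/-! ### The crux alone gives Bateman–Horn in degree `≤ 2` -/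

/-- **The rung law for ONE system of degree `≤ 2` proves Bateman–Horn for that system.**  For a
Bateman–Horn system `f` all of whose coordinates have degree `≤ 2`, the body of `RoughValueLaw` at
`f` (Buchstab shape of the jointly rough values for every `u > 2`, SOME constant) implies
`BatemanHornAsymptotic f`: the layer is the PROVED `layerConclusion_of_natDegree_le_two`, the
calibration the PROVED `sieveCalibration_proof`. [folklore] -/
theorem batemanHornAsymptotic_of_systemRoughValueLaw {k : ℕ} {f : Fin k → ℤ[X]}
    (hf : IsBatemanHornSystem f) (hdeg : ∀ i, (f i).natDegree ≤ 2)
    (hR : ∀ ω : ℝ → ℝ, ((∀ u : ℝ, 1 ≤ u → u ≤ 2 → ω u = u⁻¹) ∧ ContinuousOn ω (Set.Ici 1) ∧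
        (∀ u : ℝ, 2 < u → HasDerivAt (fun t : ℝ => t * ω t) (ω (u - 1)) u)) →
      ∃ A : ℝ, ∀ u : ℝ, 2 < u → Tendsto (fun x : ℕ =>
        (((Finset.Icc 1 x).filter (fun n : ℕ => ∀ i, 0 < (f i).eval (n : ℤ) ∧
          ∀ p ∈ Finset.range ⌈(x : ℝ) ^ (((f i).natDegree : ℝ) / u)⌉₊,
            p.Prime → ¬ ((p : ℤ) ∣ (f i).eval (n : ℤ)))).card : ℝ) * Real.log x ^ k / (x : ℝ))
        atTop (𝓝 (A * (u * ω u) ^ k))) :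
    BatemanHornAsymptotic f :=
  batemanHornAsymptotic_of_parts hf hR (layerConclusion_of_natDegree_le_two k f hf hdeg)
    (sieveCalibration_proof k f hf)

/-- **STRENGTH CERTIFICATE.**  `RoughValueLaw` implies the Bateman–Horn asymptotic for EVERY
Bateman–Horn system all of whose coordinates have degree `≤ 2` — in particular the Hardy–Littlewood
prime `k`-tuple conjecture for every admissible linear system (twin primes, Sophie Germain primes, …),
Hardy–Littlewood's Conjecture E (`n² + 1`), and Bateman–Horn for every system of linear and quadratic
polynomials. [folklore] -/
theorem batemanHornAsymptotic_of_roughValueLaw :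
    Summit.Parity.BatemanHorn.Theses.RoughValueTransport.RoughValueLaw →
      ∀ (k : ℕ) (f : Fin k → ℤ[X]), IsBatemanHornSystem f → (∀ i, (f i).natDegree ≤ 2) →
        BatemanHornAsymptotic f :=
  fun hR k f hf hdeg => batemanHornAsymptotic_of_systemRoughValueLaw hf hdeg (hR k f hf)

/-! ### Named corollaries: twin primes, Sophie Germain, `n² + 1` -/

/-- The twin system `(X, X + 2)` has coordinates of degree `≤ 2` (both `1`). [folklore] -/
theorem natDegree_twinSystem_le_two : ∀ i, (twinSystem i).natDegree ≤ 2 := by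
  intro i
  fin_cases i
  · simp [twinSystem]
  · show ((X : ℤ[X]) + 2).natDegree ≤ 2
    have h : ((X : ℤ[X]) + 2).natDegree = 1 := by simpa using natDegree_X_add_C (2 : ℤ)
    omega

/-- **The rung law for the twin system ALONE proves the Hardy–Littlewood twin asymptotic**
`π₂(x) ∼ 2C₂·x/(log x)²` (`C₂ = twinPrimeConst`; the Bateman–Horn constant of `(X, X+2)` is `2C₂` by
the PROVED `tendsto_twinPrimeConstPartial_holds`). [folklore] -/
theorem twinPrimeCount_isEquivalent_of_systemRoughValueLaw
    (hR : ∀ ω : ℝ → ℝ, ((∀ u : ℝ, 1 ≤ u → u ≤ 2 → ω u = u⁻¹) ∧ ContinuousOn ω (Set.Ici 1) ∧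
        (∀ u : ℝ, 2 < u → HasDerivAt (fun t : ℝ => t * ω t) (ω (u - 1)) u)) →
      ∃ A : ℝ, ∀ u : ℝ, 2 < u → Tendsto (fun x : ℕ =>
        (((Finset.Icc 1 x).filter (fun n : ℕ => ∀ i, 0 < (twinSystem i).eval (n : ℤ) ∧
          ∀ p ∈ Finset.range ⌈(x : ℝ) ^ (((twinSystem i).natDegree : ℝ) / u)⌉₊,
            p.Prime → ¬ ((p : ℤ) ∣ (twinSystem i).eval (n : ℤ)))).card : ℝ) *
          Real.log x ^ 2 / (x : ℝ))
        atTop (𝓝 (A * (u * ω u) ^ 2))) :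
    (fun x : ℕ => (twinPrimeCount x : ℝ)) ~[atTop]
      fun x : ℕ => 2 * twinPrimeConst * x / Real.log x ^ 2 := by
  obtain ⟨C, hC, hQ⟩ :=
    batemanHornAsymptotic_of_systemRoughValueLaw isBatemanHornSystem_twinSystem
      natDegree_twinSystem_le_two hR
  have hCeq : C = 2 * twinPrimeConst :=
    tendsto_nhds_unique hC (hasBatemanHornConst_twinSystem tendsto_twinPrimeConstPartial_holds)
  convert hQ using 2 with x x
  · rw [polyPrimeCount_twinSystem]
  · have hdeg : ((X : ℤ[X]) + 2).natDegree = 1 := by simpa using natDegree_X_add_C (2 : ℤ)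
    simp [twinSystem, hCeq, hdeg]

/-- **`RoughValueLaw` ⇒ the Hardy–Littlewood twin prime asymptotic** `π₂(x) ∼ 2C₂·x/(log x)²`.
[folklore] -/
theorem twinPrimeCount_isEquivalent_of_roughValueLaw (hR : RoughValueLaw) :
    (fun x : ℕ => (twinPrimeCount x : ℝ)) ~[atTop]
      fun x : ℕ => 2 * twinPrimeConst * x / Real.log x ^ 2 :=
  twinPrimeCount_isEquivalent_of_systemRoughValueLaw (hR 2 twinSystem isBatemanHornSystem_twinSystem)

/-- **`RoughValueLaw` ⇒ the twin prime conjecture** (`Literature.NumberTheory.Sieve.TwinPrimeConjecture`: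
beyond every `n` a twin pair), via `π₂(x) ∼ 2C₂x/(log x)² → ∞` (`C₂ > 0`: `twinPrimeConst_pos_holds`).
[folklore] -/
theorem twinPrimeConjecture_of_roughValueLaw (hR : RoughValueLaw) : TwinPrimeConjecture := by
  have hC2 : 0 < twinPrimeConst := twinPrimeConst_pos_holds
  refine twinPrimeConjecture_of_tendsto
    ((twinPrimeCount_isEquivalent_of_roughValueLaw hR).symm.tendsto_atTop ?_)
  have := tendsto_natCast_div_log_sq_atTop.const_mul_atTop (mul_pos two_pos hC2)
  simpa [mul_div_assoc] using this

/-- **`RoughValueLaw` ⇒ Bateman–Horn for the Sophie Germain system** `(X, 2X + 1)`. [folklore] -/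
theorem sophieGermain_of_roughValueLaw (hR : RoughValueLaw) : BatemanHornAsymptotic sgSystem := by
  refine batemanHornAsymptotic_of_roughValueLaw hR _ _ isBatemanHornSystem_sgSystem fun i => ?_
  fin_cases i
  · simp [sgSystem]
  · show (C (2 : ℤ) * X + C 1 : ℤ[X]).natDegree ≤ 2
    exact (natDegree_linear_le (a := (2 : ℤ)) (b := 1)).trans (by norm_num)

/-- **`RoughValueLaw` ⇒ Hardy–Littlewood's Conjecture E** (`#{n ≤ x : n² + 1 prime} ∼ (𝔖/2)·x/log x`),
as Bateman–Horn for the single quadratic `X² + 1` (`batemanHornAsymptotic_X_sq_add_one_iff`).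
[folklore] -/
theorem hardyLittlewoodConjE_of_roughValueLaw (hR : RoughValueLaw) : HardyLittlewoodConjE := by
  refine batemanHornAsymptotic_X_sq_add_one_iff.mp
    (batemanHornAsymptotic_of_roughValueLaw hR _ _ isBatemanHornSystem_X_sq_add_one fun i => ?_)
  fin_cases i
  show (X ^ 2 + 1 : ℤ[X]).natDegree ≤ 2
  have h : (X ^ 2 + 1 : ℤ[X]).natDegree = 2 := by
    simpa using natDegree_X_pow_add_C (n := 2) (r := (1 : ℤ))
  omega

/-- **`RoughValueLaw` ⇒ Landau's problem**: `n² + 1` is prime for infinitely many `n`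
(`Literature.NumberTheory.Sieve.LandauConjecture`). [folklore] -/
theorem landauConjecture_of_roughValueLaw (hR : RoughValueLaw) : LandauConjecture :=
  (hardyLittlewoodConjE_of_roughValueLaw hR).landauConjecture

end Summit.Parity.BatemanHorn.Cruxes.RoughValueLaw.Strength

end
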